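/-
Copyright: cell pub-balaban-gaps (YM BLITZ Y1, track G1), seat g1-p2 (unit `pub-balaban-gaps-g1-p2-g0`).  Binder (D4) of the
B12-Theorem-2 wall — the wall END with (D4) as ONE binder, the END from the binder's named RESIDUE (`Beta.RemainderResidue.AtSlope`), and the residue's non-vacuity at the cell's zero-activity witness; kernel bookkeeping BY IMPORT over the an4 chain
(nothing restated).  HONEST FRAMING: nothing of Bałaban's series is asserted; no instance of the residue for Bałaban's split exists
in the tree (instance 0/1); NOT `BetaPertH`, NOT the continuum limit, NOT Clay, NOT summit progress.
-/
import Mathlib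
import Literature.MathematicalPhysics.QuantumFieldTheory.Balaban1983to89.Beta.RemainderResidue
import Literature.MathematicalPhysics.QuantumFieldTheory.Balaban1983to89.Beta.RemainderResidueFamily
import Literature.MathematicalPhysics.QuantumFieldTheory.Balaban1983to89.Beta.RemainderWitness
import Literature.MathematicalPhysics.QuantumFieldTheory.Balaban1983to89.Beta.OneStepKernelFamily

/-!
# `Gaps.D4Residue` — binder (D4) «`RemainderConst` leaves for Bałaban's split» of the B12-Theorem-2 wall: the END with (D4) as
# ONE binder, the END from the named residue, and non-vacuity (cell pub-balaban-gaps, track G1, seat g1-p2)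

HONEST DEPENDENCY (cell pub-balaban, verbatim): continuum YM on T⁴ ⇐ BetaPertH ∧ nine spine estimates (0/9 proved);
BetaPertH ⇐ (D1) ∧ (D4) ∧ CAP+tail.  HONEST FRAMING: this module proves NO estimate of Bałaban's series.  The β-functions of a
construction `Cn : B12.Construction` are FREE DATA of the typing (`B12.RunData.flow`), so (D4) is a HYPOTHESIS ON DATA,
dischargeable only for a CONSTRUCTED instance of Bałaban's small-field step (the cell's NODE O, size XL, no owner).  Every proof
below is a few lines over theorems already in the tree (an4 lineage `Beta.RemainderChain` … `Beta.RemainderDecay190`,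
`Beta.RemainderWitness`, `Beta.DriftRemainder`, `Beta.OneStepKernelFamily`; this seat's Literature leaf `Beta.RemainderResidue`),
imported, not restated.  Statement-layer record for the cell table `BALABAN-GAPS.md` row D4 and the census `g1/RESIDUE.md`.

CITATION HEADER (lean-in-tree rule).  [I] = [Balaban1987RG1] Commun. Math. Phys. 109: Thm 2 p. 259, Thm 3 p. 264, (1.20)–(1.22)
p. 264; [II] = [Balaban1988RG2Cluster] Commun. Math. Phys. 116: Lemma 3 (2.38) p. 20, p. 21.  Quotations as certified in the
imported modules; `[cite: …]` tags are CONTEXT ONLY; the manuscripts under audit are not cited for their deferred steps.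

## What is here

* §1 `endpointExistence_of_D1Drift_D4` — the wall END `Beta.OneStepKernelFamily.endpointExistence_of_D1Drift` with its pair
  `(hrem : RemainderConst Sβ γ₀ rr) (hr : rr ≤ stepBal N Lc)` COLLAPSED to the one binder `RemainderConst Sβ γ₀ (stepBal N Lc)`
  (`Beta.RemainderResidue.wallPair_iff`).  (D4) by tree name = THIS hypothesis.
* §2 `endpointExistence_of_D1Drift_atSlope` — the END from the residue AT THE ONE-LOOP SLOPE (`AtSlope Sβ γ₀ (stepBal N Lc)`:
  an inhabitant of `ChainTFac190H 4 M μ ν Sβ γ₀ c ℓ α₂ q` (holomorphic currency of record, G1-PLAN-D4 §3.1) + N1–N3) — the residue of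
  the ONE construction of the wall; and `endpointExistence_of_D1Drift_windowedLower` — the END in the WEAKEST (D4)-currency
  (`WindowedLower`: windowed lower sums of β¹ at rate `stepBal N Lc`, + the upper quarter `β¹ ≤ r'` for (UP), + (C)), via
  `FlowStepRuns.endpointExistence_of_partialSums`.  (The ENDs over the FAMILY of constructions indexed by the activity parameter —
  `Beta.RemainderResidueFamily.EpsFamily` / `ObjectsFamily`, the residue of record for Bałaban's scheme — follow in v1.1 of this file
  once that Literature leaf lands.)
* §3 NON-VACUITY: `atSlope_splitZero`, `residue_side_inhabited` — the slope-`s` residue is INHABITED at the zero-activity witness of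
  `Beta.RemainderWitness` (trivial step, split `splitZero`, records `c₀ 4`, `q₀`), so the predicate is satisfiable as typed; for
  BAŁABAN's construction the count is 0/1.

* §4 (v1.1, APPEND-ONLY) THE ENDs OVER THE FAMILY OF CONSTRUCTIONS indexed by the activity parameter ε₁ (`Beta.RemainderResidueFamily`,
  p340749 — the residue of record for Bałaban's scheme; [II] (1.34)/(2.22): ε₁ is the construction's own small-field threshold, so «ε₁
  sufficiently small» CHOOSES the member): `exists_endpointExistence_of_D1Drift_epsFamily` / `_objectsFamily` — SOME member has endpoint
  existence, rows D1 ∕ (C) consumed FOR THAT MEMBER (row-D4 owner's R4); constant-family non-vacuity `objectsFamily_const_splitZero`,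
  `epsFamily_const_splitZero`.

## What is NOT here

No object of Bałaban's is constructed; no leaf L1–L11 of the cell ledger (`BETA/REMAINDER-BETA.md` §8) is discharged; the
exact missing lemma (`AtSlope` for the ONE construction of the wall; `Beta.RemainderResidueFamily.ObjectsFamily` for Bałaban's family of constructions) and the repair census are in `g1/RESIDUE.md`.
No `def`, no `sorry`, no axiom beyond the standard trio.
-/

namespace Summit.QuantumFields.BalabanUV.Gaps.D4Residue

open Literature.MathematicalPhysics.QuantumFieldTheory.Balaban1983to89
open FlowStep DagBinding FlowStepRuns
open Literature.MathematicalPhysics.QuantumFieldTheory.Balaban1983to89.Beta.RemainderChain (RemainderConst)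
open Literature.MathematicalPhysics.QuantumFieldTheory.Balaban1983to89.Beta.RemainderChainLattice (CondsL SignsL remCoeffL)
open Literature.MathematicalPhysics.QuantumFieldTheory.Balaban1983to89.Beta.RemainderDecay190 (Consts190 ChainTFac190)
open Literature.MathematicalPhysics.QuantumFieldTheory.Balaban1983to89.Beta.RemainderDecay190HoloChain (ChainTFac190H)
open Literature.MathematicalPhysics.QuantumFieldTheory.Balaban1983to89.Beta.RemainderWitness
  (c₀ q₀ splitZero zeroChain190 c₀_condsL c₀_R22gen c₀_activity_pos q₀_valid_c₀)
open Literature.MathematicalPhysics.QuantumFieldTheory.Balaban1983to89.Beta.RemainderResidue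
  (AtSlope WindowedLower wallPair_iff remainderConst_restrict remainderConst_of_atSlope betaPartialSumsLowerH_of_drift_windowedLower)
open Literature.MathematicalPhysics.QuantumFieldTheory.Balaban1983to89.Beta.OneStepKernelFamily (D1Drift TbalOf)
open Literature.MathematicalPhysics.QuantumFieldTheory.Balaban1983to89.Beta.OneStepResolventKernel (JetData)

noncomputable section

/-! ## §1. The wall END with (D4) as ONE binder -/

section Wall

variable {Lc : ℕ} [NeZero Lc]

/-- **The wall END with (D4) as ONE binder**: `Beta.OneStepKernelFamily.endpointExistence_of_D1Drift` at `rr := stepBal N Lc` —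
forward generation, the split with its one-loop part pinned to the typed step kernels (`hβ`, row D1's identification), the drift
`D1Drift` (row D1), (D4) `RemainderConst Sβ γ₀ (stepBal N Lc)`, joint continuity (C) ⟹ endpoint existence ([I] Thm 2, first
sentence).  Discharges nothing: every binder is a hypothesis. [cite: Balaban1987RG1, Thm 2 p.259 (first sentence)] -/
theorem endpointExistence_of_D1Drift_D4 {β : HBeta} {Cn : B12.Construction} (hgen : ForwardGenerated Cn β)
    (Sβ : B12Beta.OneLoopSplit β) (Js : ℕ → JetData 3 Lc) {N : ℝ} {μ ν : Fin 4}
    (hβ : ∀ j, Sβ.β0 j = B12Beta.secondMoment (TbalOf Lc Js j) μ ν) (hD : D1Drift Lc Js N μ ν) {γ₀ : ℝ} (hγ₀ : 0 < γ₀)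
    (hD4 : RemainderConst Sβ γ₀ (B12Normalization.stepBal N Lc)) (hcont : BetaContH γ₀ β) : EndpointExistence Cn :=
  Beta.OneStepKernelFamily.endpointExistence_of_D1Drift hgen Sβ Js hβ hD hγ₀ hD4 le_rfl hcont

/-- The same with the wall's PAIR displayed and collapsed by `wallPair_iff` (the two currencies agree).
[cite: Balaban1987RG1, Thm 2 p.259 (first sentence)] -/
theorem endpointExistence_of_D1Drift_pair {β : HBeta} {Cn : B12.Construction} (hgen : ForwardGenerated Cn β)
    (Sβ : B12Beta.OneLoopSplit β) (Js : ℕ → JetData 3 Lc) {N : ℝ} {μ ν : Fin 4}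
    (hβ : ∀ j, Sβ.β0 j = B12Beta.secondMoment (TbalOf Lc Js j) μ ν) (hD : D1Drift Lc Js N μ ν) {γ₀ : ℝ} (hγ₀ : 0 < γ₀)
    (hpair : ∃ rr : ℝ, RemainderConst Sβ γ₀ rr ∧ rr ≤ B12Normalization.stepBal N Lc) (hcont : BetaContH γ₀ β) :
    EndpointExistence Cn :=
  endpointExistence_of_D1Drift_D4 hgen Sβ Js hβ hD hγ₀ ((wallPair_iff Sβ γ₀ _).1 hpair) hcont

end Wall

/-! ## §2. The wall END from the named residue -/

section WallResidue

variable {Lc : ℕ} [NeZero Lc]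

/-- **The wall END from the residue at the one-loop slope**: `D1Drift` + `AtSlope Sβ γ₀ (stepBal N Lc)` + (C).
[cite: Balaban1987RG1, Thm 2 p.259 (first sentence); Balaban1988RG2Cluster, (2.38) p.20] -/
theorem endpointExistence_of_D1Drift_atSlope {β : HBeta} {Cn : B12.Construction} (hgen : ForwardGenerated Cn β)
    (Sβ : B12Beta.OneLoopSplit β) (Js : ℕ → JetData 3 Lc) {N : ℝ} {μ ν : Fin 4}
    (hβ : ∀ j, Sβ.β0 j = B12Beta.secondMoment (TbalOf Lc Js j) μ ν) (hD : D1Drift Lc Js N μ ν) {γ₀ : ℝ} (hγ₀ : 0 < γ₀)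
    (hres : AtSlope Sβ γ₀ (B12Normalization.stepBal N Lc)) (hcont : BetaContH γ₀ β) : EndpointExistence Cn :=
  endpointExistence_of_D1Drift_D4 hgen Sβ Js hβ hD hγ₀ (remainderConst_of_atSlope hres) hcont

/-- **The wall END in the WEAKEST (D4)-currency**: drift of the pinned one-loop coefficients (`D1Drift`, slope `stepBal N Lc`, some
defect `A`) + the WINDOWED lower form `WindowedLower Sβ γ₀ (stepBal N Lc) M'` (β¹'s window sums ≥ −(M' + slope·length)) + the upper
quarter `β¹ ≤ r'` on the boxes (feeds the printed-type upper bound (UP), `DriftRemainder.betaUpperH_of_drift_oneSided`) + joint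
continuity (C) ⟹ endpoint existence, via `FlowStepRuns.endpointExistence_of_partialSums`.  Every binder a hypothesis; nothing
discharged. [cite: Balaban1987RG1, Thm 2 p.259 (first sentence) and §1 p.264] -/
theorem endpointExistence_of_D1Drift_windowedLower {β : HBeta} {Cn : B12.Construction} (hgen : ForwardGenerated Cn β)
    (Sβ : B12Beta.OneLoopSplit β) (Js : ℕ → JetData 3 Lc) {N : ℝ} {μ ν : Fin 4}
    (hβ : ∀ j, Sβ.β0 j = B12Beta.secondMoment (TbalOf Lc Js j) μ ν) (hD : D1Drift Lc Js N μ ν) {γ₀ M' r' : ℝ}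
    (hγ₀ : 0 < γ₀) (hM' : 0 ≤ M') (hwin : WindowedLower Sβ γ₀ (B12Normalization.stepBal N Lc) M')
    (hup1 : ∀ k (p : Fin (k + 1) → ℝ), p ∈ B12Beta.HistBox γ₀ k → Sβ.β1 k p ≤ r') (hr' : 0 ≤ r')
    (hslope : 0 ≤ B12Normalization.stepBal N Lc) (hcont : BetaContH γ₀ β) : EndpointExistence Cn := by
  obtain ⟨A, hA⟩ := hD
  have hβfun : Sβ.β0 = fun j => B12Beta.secondMoment (TbalOf Lc Js j) μ ν := funext hβ
  have hA' : Beta.Drift.OneLoopDrift (B12Normalization.stepBal N Lc) A Sβ.β0 := by rw [hβfun]; exact hA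
  exact endpointExistence_of_partialSums hgen hγ₀ (by linarith [hA'.nonneg]) (by linarith [hA'.nonneg])
    hcont (betaPartialSumsLowerH_of_drift_windowedLower Sβ hA' hwin le_rfl)
    (Beta.DriftRemainder.betaUpperH_of_drift_oneSided Sβ hA' hup1)

end WallResidue

/-! ## §3. Non-vacuity: both residues are inhabited at the zero-activity witness of `Beta.RemainderWitness` -/

/-- `δ₀(c₀ 4) = 1 > 0` (the witness record of `Beta.RemainderWitness`). [folklore] -/
theorem c₀_four_δ₀_pos : 0 < (c₀ 4).δ₀ := by
  show (0 : ℝ) < 1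
  norm_num

/-- **The slope-`s` residue is inhabited** for the trivial split `splitZero` at the witness constants `c₀ 4`, `ℓ = 2`, `α₂ = 1`,
`q₀`, any `M ≥ 1`, any box, at the slope `s := ε₁(c₀ 4) · K_rem,L(4, M, c₀ 4, 1, B₃(q₀))` — so the predicate is satisfiable as
typed (the count for Bałaban's split stays 0/1). [folklore] -/
theorem atSlope_splitZero (M : ℕ) [NeZero M] (γ₀ : ℝ) :
    AtSlope splitZero γ₀ ((c₀ 4).ε₁ * remCoeffL 4 M (c₀ 4) 1 q₀.B₃) :=
  ⟨M, inferInstance, 0, 1, c₀ 4, 2, 1, q₀, ⟨ChainTFac190H.ofAnalytic (zeroChain190 4 M 0 1 γ₀ (c₀ 4) 2 1 (c₀_activity_pos 4).le)⟩,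
    c₀_condsL 4,
    c₀_R22gen 4, q₀_valid_c₀ 4, (q₀_valid_c₀ 4).signsL (c₀_activity_pos 4).le one_pos c₀_four_δ₀_pos, le_rfl⟩

/-- **The wall END is NOT VACUOUS on the residue side**: at the `RemainderWitness` zero-activity world every binder of
`endpointExistence_of_D1Drift_D4`'s remainder slot is met by `atSlope_splitZero` — recorded as the conjunction «residue at the
witness slope ∧ its `RemainderConst` consequence». [folklore] -/
theorem residue_side_inhabited (M : ℕ) [NeZero M] (γ₀ : ℝ) :
    AtSlope splitZero γ₀ ((c₀ 4).ε₁ * remCoeffL 4 M (c₀ 4) 1 q₀.B₃) ∧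
      RemainderConst splitZero γ₀ ((c₀ 4).ε₁ * remCoeffL 4 M (c₀ 4) 1 q₀.B₃) :=
  ⟨atSlope_splitZero M γ₀, remainderConst_of_atSlope (atSlope_splitZero M γ₀)⟩

/-! ## §4 (v1.1). The wall END over the FAMILY of constructions (`Beta.RemainderResidueFamily`, p340749) and its non-vacuity -/

section WallFamily

open Literature.MathematicalPhysics.QuantumFieldTheory.Balaban1983to89.Beta.RemainderResidue (constsAt)
open Literature.MathematicalPhysics.QuantumFieldTheory.Balaban1983to89.Beta.RemainderResidueFamily
  (EpsFamily ObjectsFamily exists_remainderConst_of_epsFamily epsFamily_of_objectsFamily)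
open Literature.MathematicalPhysics.QuantumFieldTheory.Balaban1983to89.Beta.RemainderWitness (c₀_C3act)

variable {Lc : ℕ} [NeZero Lc]

/-- **The wall END over the FAMILY of constructions indexed by the activity parameter**: constructions `Cf e` (small-field ∕ activity
parameter `e`; [II] p. 21 «ε₁ sufficiently small» = a choice of `e`), each forward-generated with its β-functions `βf e` split as `Sf e`
whose one-loop part is pinned to the SAME typed step kernels (`hβ`, row D1 — the one-loop coefficients are Gaussian and do not see
the activity parameter), the drift `D1Drift` (row D1), the ε₁-UNIFORM residue `EpsFamily βf Sf` (row D4's sharper residue), and joint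
continuity of every member on some box ⟹ SOME member of the family (one with `e·K_rem,L ≤ stepBal N Lc`) has endpoint existence.
The slope `stepBal N Lc = (11N²/12π²)·log Lc` is positive for `N > 0`, `Lc ≥ 2`; boxes are intersected (both binders antitone).  THE
JUNCTION WITH ROWS D1 ∕ (C) (row-D4 owner's remark R4, an4 g85): the conclusion returns SOME member `e`; the drift `hD`, the identification
`hβ` and the continuity `hcont` are then CONSUMED FOR THAT MEMBER — here they are asked of every member (`∀ e`), which is the print
reading: the one-loop coefficients β⁰ are Gaussian ([I] (1.22)/(1.4)) and do not see the activity parameter, so `hβ` pins the SAME typed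
kernels `TbalOf Lc Js` for all members, and (C) is [I] p. 264's clause for each construction.  Every binder a hypothesis; nothing
discharged. [cite: Balaban1987RG1, Thm 2 p.259 (first sentence) and Thm 3 p.264; Balaban1988RG2Cluster, (2.38) p.20 and p.21] -/
theorem exists_endpointExistence_of_D1Drift_epsFamily {βf : ℝ → HBeta} {Cf : ℝ → B12.Construction}
    (hgen : ∀ e, ForwardGenerated (Cf e) (βf e)) (Sf : (e : ℝ) → B12Beta.OneLoopSplit (βf e)) (Js : ℕ → JetData 3 Lc)
    {N : ℝ} (hN : 0 < N) (hLc : 2 ≤ Lc) {μ ν : Fin 4}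
    (hβ : ∀ e j, (Sf e).β0 j = B12Beta.secondMoment (TbalOf Lc Js j) μ ν) (hD : D1Drift Lc Js N μ ν)
    (hres : EpsFamily βf Sf) (hcont : ∀ e, 0 < e → ∃ γc : ℝ, 0 < γc ∧ BetaContH γc (βf e)) :
    ∃ e : ℝ, 0 < e ∧ EndpointExistence (Cf e) := by
  have hLc' : (1 : ℝ) < (Lc : ℝ) := by exact_mod_cast hLc
  obtain ⟨e, he, γ₀, hγ₀, hD4⟩ := exists_remainderConst_of_epsFamily hres (B12Normalization.stepBal_pos hN hLc')
  obtain ⟨γc, hγc, hc⟩ := hcont e he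
  exact ⟨e, he, endpointExistence_of_D1Drift_D4 (hgen e) (Sf e) Js (hβ e) hD (lt_min hγ₀ hγc)
    (remainderConst_restrict (min_le_left γ₀ γc) hD4) fun k => (hc k).mono (box_mono (min_le_right γ₀ γc) k)⟩

/-- **The wall END from `D1Drift` + the PURE OBJECT residue `ObjectsFamily βf Sf` + joint continuity of every member** — the form
in which the exact missing lemma of row D4 (an inhabitant of `ObjectsFamily` for Bałaban's family of constructions) would be
CONSUMED: some member of the family has endpoint existence.  Every binder a hypothesis; nothing discharged.
[cite: Balaban1987RG1, Thm 2 p.259 (first sentence) and Thm 3 p.264; Balaban1988RG2Cluster, (2.38) p.20 and p.21] -/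
theorem exists_endpointExistence_of_D1Drift_objectsFamily {βf : ℝ → HBeta} {Cf : ℝ → B12.Construction}
    (hgen : ∀ e, ForwardGenerated (Cf e) (βf e)) (Sf : (e : ℝ) → B12Beta.OneLoopSplit (βf e)) (Js : ℕ → JetData 3 Lc)
    {N : ℝ} (hN : 0 < N) (hLc : 2 ≤ Lc) {μ ν : Fin 4}
    (hβ : ∀ e j, (Sf e).β0 j = B12Beta.secondMoment (TbalOf Lc Js j) μ ν) (hD : D1Drift Lc Js N μ ν)
    (hres : ObjectsFamily βf Sf) (hcont : ∀ e, 0 < e → ∃ γc : ℝ, 0 < γc ∧ BetaContH γc (βf e)) :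
    ∃ e : ℝ, 0 < e ∧ EndpointExistence (Cf e) :=
  exists_endpointExistence_of_D1Drift_epsFamily hgen Sf Js hN hLc hβ hD (epsFamily_of_objectsFamily hres) hcont

/-- **The pure object residue is inhabited by the CONSTANT family at the trivial split**: the record `c₀ 4` (its `ε₁ = ε₁_thr/162 > 0`),
`ℓ = 2`, `α₂ = 1`, `q₀`, and for every activity `e ∈ ]0, ε₁(c₀ 4)]` the zero chain at `constsAt (c₀ 4) e` on the box `]0,1]` — so the
predicate is satisfiable as typed (the count for Bałaban's family stays 0/1). [folklore] -/
theorem objectsFamily_const_splitZero (M : ℕ) [NeZero M] :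
    ObjectsFamily (fun _ => fun _ _ => (1 : ℝ)) (fun _ => splitZero) := by
  have hC3 : (c₀ 4).C3act = 162 := c₀_C3act 4
  have hε₀ : 0 < (c₀ 4).ε₁ := by
    have h := c₀_activity_pos 4
    rw [hC3] at h
    linarith
  refine ⟨M, inferInstance, 0, 1, c₀ 4, 2, 1, q₀, hε₀, c₀_condsL 4, c₀_R22gen 4, q₀_valid_c₀ 4,
    (q₀_valid_c₀ 4).signsL (c₀_activity_pos 4).le one_pos c₀_four_δ₀_pos, fun e he _ => ⟨1, one_pos, ⟨?_⟩⟩⟩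
  refine ChainTFac190H.ofAnalytic (zeroChain190 4 M 0 1 1 (constsAt (c₀ 4) e) 2 1 ?_)
  show 0 ≤ (c₀ 4).C3act * e
  rw [hC3]; positivity

/-- **The ε₁-uniform residue is inhabited by the constant family at the trivial split** (`epsFamily_of_objectsFamily` at the witness).
[folklore] -/
theorem epsFamily_const_splitZero (M : ℕ) [NeZero M] : EpsFamily (fun _ => fun _ _ => (1 : ℝ)) (fun _ => splitZero) :=
  epsFamily_of_objectsFamily (objectsFamily_const_splitZero M)

end WallFamily

end

end Summit.QuantumFields.BalabanUV.Gaps.D4Residue
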